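import Summits.CriticalPhenomena.Ising3DConformalLimit.Theses.PrimaryAtInfinity
import Summits.CriticalPhenomena.Ising3DConformalLimit.Theorems.PrecisionLaplacianMoebiusLimitOfTwoPointLawInversionBegetsRotations
import Summits.CriticalPhenomena.Ising3DConformalLimit.Theorems.PrecisionLaplacianMoebiusLimitOfTwoPointLawReflectInvertOfSCT
import Summits.CriticalPhenomena.Ising3DConformalLimit.Theorems.PrecisionLaplacianMoebiusLimitOfTwoPointLawScaleOfSCT
import Summits.CriticalPhenomena.Ising3DConformalLimit.Theorems.PrecisionLaplacianMoebiusLimitOfTwoPointLawInversionOfReflectInvert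
import Summits.CriticalPhenomena.Ising3DConformalLimit.Theorems.PrecisionLaplacianMoebiusLimitOfTwoPointLawSCTOfWard
import HarnessLib

/-!
# Item stmt-CriticalPhenomena-5357 `PrimaryAtInfinity.WardToMoebius` — weak special-conformal Ward identities
# integrate to Möbius covariance (line `multipole-ward-nonsat-endpoint` of crux `MoebiusLimitOfTwoPointLaw`, item 4801)

`wardToMoebius : PrimaryAtInfinity.WardToMoebius`: a family `S : CorrFamily 3` that vanishes off `NonCoincident`, is
continuous on it, translation and parity invariant, and satisfies the weak `K_b`-identities
`∫ S_n [(2Δ−6)(Σ⟪b,xᵢ⟫)φ + Dφ·(‖xᵢ‖²b − 2⟪b,xᵢ⟫xᵢ)ᵢ] = 0` for all `n`, `b` and all smooth `φ` compactly supported in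
`NonCoincident 3 n`, is `IsMoebiusCovariant Δ S`.

Proof = composition of the landed stubs of the line (no flow along the special conformal vector field, whose
orbits pass through `∞`; instead `K = ιPι` and explicit words in the group generated by translations and SCTs):
* `stub_sctOfWard` (p100147): the `K`-identity integrates to covariance under the finite special conformal maps
  `x ↦ (x + ‖x‖²a)/(1 + 2⟪a,x⟫ + ‖a‖²‖x‖²)` along pole-free paths;
* `stub_reflectInvertOfSCT` (p97832): with translations, covariance under `J_b = τ_{−b} SCT_b τ_{−b} = ι ∘ R_b`;
* `stub_scaleOfSCT` (p99350): dilations are words, `D_{λ²} = τ_{λb} SCT_{−b/λ} τ_{(λ−1)b} SCT_b τ_{−b}`;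
* `stub_inversionOfReflectInvert` (p98963): `ι ∘ (−1) = J_b J_w J_{w'}` for an orthonormal frame, parity;
* `stub_inversionBegetsRotations` (p86170, item 4675): translations + unit inversion ⇒ `O(3)` (Cartan–Dieudonné).

References: Di Francesco–Mathieu–Sénéchal 1997 §4.1–4.3 [FrancescoMathieuSenechal1997]; Lüscher–Mack 1975
(`⟨P, K⟩ = so(4,1)`) [LuscherMack1975].
-/

noncomputable section

namespace Summit.CriticalPhenomena.Ising3DConformalLimit.PrecisionLaplacianMoebiusLimitOfTwoPointLaw

open Literature.Probability.LatticeModels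
open Summit.CriticalPhenomena.Ising3DConformalLimit.Theses

/-- **Item 5357 `PrimaryAtInfinity.WardToMoebius`.** Weak special-conformal Ward identities (all arities and
directions) + translation and parity invariance + continuity off the diagonals + normalisation off
`NonCoincident` ⇒ `IsMoebiusCovariant Δ S`. Composition of the line's landed stubs: SCT covariance from the Ward
identity (`stub_sctOfWard`), reflect-inverts (`stub_reflectInvertOfSCT`), dilations (`stub_scaleOfSCT`), the unit
inversion (`stub_inversionOfReflectInvert`) and the group lemma `stub_inversionBegetsRotations` (item 4675). -/
theorem wardToMoebius : PrimaryAtInfinity.WardToMoebius := by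
  intro S Δ hnorm hcont htr hpar hK
  have hsct := stub_sctOfWard S Δ hnorm hcont hK
  have hJ := stub_reflectInvertOfSCT S Δ htr hsct
  have hinv : IsInversionCovariant Δ S := stub_inversionOfReflectInvert S Δ hnorm hpar hJ
  have hrot : IsRotationInvariant S := stub_inversionBegetsRotations Δ S htr hinv
  exact ⟨⟨htr, hrot⟩, stub_scaleOfSCT S Δ hnorm htr hsct, hinv⟩

end Summit.CriticalPhenomena.Ising3DConformalLimit.PrecisionLaplacianMoebiusLimitOfTwoPointLaw

end
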